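import Summits.QuantumFields.YangMills.Theses.PoincareLipschitz
import HarnessLib

/-!
# Route `PoincareLipschitz` (planner ym-r3-idea-2 g7, LINE 15 «PoincareLipschitz», lens «nearmiss»), assembly item (stmt-QuantumFields-23536) — BY NAME

`MinimiserStabilityRegPr → FluctuationComparisonRegPrIntL → MesoscopicConcentrationL → BlockLipschitzL → BlockLocalityL → MeanDeviationL →
TwoSidedOfConcentration → YM3TorusSU2`: the glue `TwoSidedOfConcentration` turns the four organs into the two tails
`FibreConvexityTail.TwoSidedTailL ∧ TowerTailL`, the landed `fibreConvexityTail_historyTailOfTwoSided_proof` turns those into the history tail, and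
the deciding theorem of route `UnitScaleTilt` (`Theses.UnitScaleTilt.closes`) combines it with the two R3 cruxes `MinimiserStabilityRegPr` (19200) and
`FluctuationComparisonRegPrIntL` (20520) into the rung-R3 leaf.  Proof = the route's own deciding λ-term.

Width seat ym-line-sfw-p2-w2 g23 (cell ym-idea-1, R3 family; free hands).  HONEST FRAMING: R3 (`YM3TorusSU2`) is a RECORD rung of LADDER-YM; the
cruxes `MesoscopicConcentrationL`, `BlockLipschitzL`, `MeanDeviationL`, 19200 and 20520 are OPEN; this is plumbing of a draft route; no summit is proved
and the Yang–Mills mass gap is NOT proved.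
-/

set_option autoImplicit false

namespace Summit.QuantumFields.YangMills.Theorems

/-- **`PoincareLipschitz.Assembly`** (item stmt-QuantumFields-23536) BY NAME: the seven hypotheses compose to the leaf exactly as in the route's deciding
theorem — `UnitScaleTilt.closes h200 h201 (historyTailOfTwoSided (two-sided tail) (tower tail))`. [folklore] -/
theorem poincareLipschitz_assembly_proof :
    Summit.QuantumFields.YangMills.Theses.PoincareLipschitz.Assembly :=
  fun h200 h201 hC hLip hLoc hM hG =>
    Summit.QuantumFields.YangMills.Theses.UnitScaleTilt.closes h200 h201
      (Summit.QuantumFields.YangMills.Theorems.fibreConvexityTail_historyTailOfTwoSided_proof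
        (hG hC hLip hLoc hM).1 (hG hC hLip hLoc hM).2)

end Summit.QuantumFields.YangMills.Theorems
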